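import Literature.AlgebraicGeometry.HodgeTheory.LinearSectionPencilFibres
import Literature.AlgebraicGeometry.HodgeTheory.HardLefschetzNFoldHolds
import Literature.AlgebraicGeometry.HodgeTheory.LefschetzDecompositionSingular
import Literature.AlgebraicGeometry.HodgeTheory.ThomGysinClosedImmersion
import Literature.AlgebraicGeometry.HodgeTheory.GysinBaseChangeOfKunneth
import Literature.AlgebraicGeometry.HodgeTheory.AlgebraicClassesHodgeTypeHolds
import Literature.AlgebraicGeometry.Motives.ProjectiveSpaceLinearSubst
import HarnessLib

/-!
# Cup product with the class of a smooth hyperplane section is injective below the middle degree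

Family `hodge`, layer `Literature/AlgebraicGeometry/HodgeTheory`. Theorems only (no definitions, no
named facts, D-0026).

Let `X ⊆ ℙᴺ` be smooth projective over `ℂ` of dimension `m + 1` (closed immersion `ι`), let
`a = (a₀, a₁)` be a pencil of linear forms with total space `X̃ ⊆ X × ℙ¹`, and let `t ∈ ℙ¹(ℂ)` be a
point whose fibre `π⁻¹(t)` is smooth projective of dimension `m`; write
`u_t : π⁻¹(t) ⟶ X̃ ⟶ X` (a closed immersion onto the hyperplane section `X ∩ H_t`,
`LinearSectionPencilFibres`). **Main theorem** (`eq_zero_of_cupProduct_complexGysin_one_eq_zero`):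
for `2p ≤ m` and `z ∈ H^{2p}(X(ℂ); ℂ)`, if `z ∪ (u_t)_* 1 = 0` then `z = 0`.

Proof ("`[X ∩ H_t]` is the hyperplane class, and hard Lefschetz"): after a linear change of
coordinates of `ℙᴺ` putting the equation `ℓ_t = t₁ a₀ − t₀ a₁` of `H_t` in a coordinate
(`exists_linearSubst_eq`, `Motives.ProjectiveSpace.substMap`), the hyperplane-type class `H = [θ]` of
the new embedding `ι'` dies off the coordinate hyperplane section `X ∩ H_t`
(`HodgeModel.restrictCompl_eq_zero_of_pullback_eq_fubiniStudy`), i.e. off the image of `u_t`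
(`range_map_fiberι_blowDown`; on complex points), hence `H ∈ ℂ · (u_t)_* 1` by Thom–Gysin for the
smooth divisor `π⁻¹(t)` (`exists_complexGysin_eq_of_isClosedImmersion`); a non-zero rational multiple
of `H` is the class of a hard Lefschetz datum (`HodgeModel.exists_hardLefschetzNFold_of_pullback_eq_fubiniStudy_smul`,
hodge.S14), whose Lefschetz operator is injective on `H^{2p}` for `2p + 1 ≤ m + 1`
(`injective_lefschetzPowTo_of_le`). (If `ℓ_t = 0` every complex point of `X` lies on `u_t(π⁻¹ t)`
and `H` dies off it trivially.)

* `exists_linearSubst_eq` — an invertible linear substitution of `k[x₀, …, x_N]` with a prescribed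
  non-zero linear form in a prescribed coordinate;
* `restrictCompl_eq_zero_of_forall_pt` — dying off a closed set only depends on its complex points;
* `exists_embedding_compl_chart_subset_range` — an embedding `ι' : X ⟶ ℙᴺ` and a chart index `j`
  with `X ∖ ι'⁻¹D₊(x_j) ⊆ u_t(π⁻¹ t)` on complex points;
* `eq_zero_of_cupProduct_complexGysin_one_eq_zero` — the main theorem.

Consumer: `HodgeTheory/PencilStepBelowMiddleOfVerdier`.

## References

* [VoisinHodgeI2002] C. Voisin, Hodge Theory and Complex Algebraic Geometry I (2002), §6.2.3
  Thm. 6.25, §7.1.2, Thm. 11.33 (proof).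
* [VoisinHodgeII2003] C. Voisin, Hodge Theory and Complex Algebraic Geometry II (2003), §1.2.2
  Thm. 1.23, §2.1.1 and §2.3.1.
* [Hartshorne1977] R. Hartshorne, Algebraic Geometry (1977), II Ex. 2.14, II Example 7.1.1.
* [DecataldoMigliorini2009] M. A. de Cataldo, L. Migliorini, On singularities of primitive cohomology
  classes, Proc. AMS 137 (2009), §4 proof of Prop. 4.5.
-/

noncomputable section

open scoped Manifold ContDiff
open CategoryTheory CategoryTheory.Limits AlgebraicGeometry MvPolynomial
open Literature.AlgebraicTopology.SingularHomology Literature.Geometry.Kaehler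
open Literature.NumberTheory.Transcendental
open Literature.AlgebraicGeometry.Motives
open Literature.AlgebraicGeometry.Motives.LinearSectionNet
open Literature.AlgebraicGeometry.Motives.AnalytificationKaehler (fubiniStudyPullbackForm)

namespace Literature.AlgebraicGeometry.HodgeTheory

section HodgeTheory

/-! ### An invertible linear substitution with a prescribed linear form in one coordinate -/

section Subst

variable {k : Type*} [Field k] {n : ℕ}

/-- **A non-zero linear form is a coordinate after an invertible linear change of coordinates.**
For `b : Fin (n+1) → k` with `b j ≠ 0` there are linear substitutions `τ, τ'` of `k[x₀, …, xₙ]`,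
inverse to each other, with `τ j = Σ_l b_l x_l`: `τ` replaces `x_j` by `ℓ = Σ b_l x_l` and fixes
the other variables, `τ'` replaces `x_j` by `b_j⁻¹ (x_j − Σ_{l ≠ j} b_l x_l)`.
[cite: Hartshorne1977, II Example 7.1.1] -/
theorem exists_linearSubst_eq (b : Fin (n + 1) → k) (j : Fin (n + 1)) (hj : b j ≠ 0) :
    ∃ (τ τ' : Fin (n + 1) → MvPolynomial (Fin (n + 1)) k) (_ : ∀ i, (τ i).IsHomogeneous 1)
      (_ : ∀ i, (τ' i).IsHomogeneous 1), (∀ q, aeval τ (aeval τ' q) = q) ∧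
        (∀ q, aeval τ' (aeval τ q) = q) ∧ τ j = ∑ l, C (b l) * X l := by
  classical
  set ℓ : MvPolynomial (Fin (n + 1)) k := ∑ l, C (b l) * X l with hℓ
  set ℓ' : MvPolynomial (Fin (n + 1)) k :=
    C (b j)⁻¹ * (X j - ∑ l ∈ Finset.univ.erase j, C (b l) * X l) with hℓ'
  have hCX : ∀ (c : k) (l : Fin (n + 1)), (C c * X l : MvPolynomial (Fin (n + 1)) k).IsHomogeneous 1 :=
    fun c l ↦ by simpa using (isHomogeneous_C (Fin (n + 1)) c).mul (isHomogeneous_X k l)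
  have hℓh : ℓ.IsHomogeneous 1 := by
    rw [hℓ]
    exact IsHomogeneous.sum _ _ _ fun l _ ↦ hCX (b l) l
  have hℓ'h : ℓ'.IsHomogeneous 1 := by
    rw [hℓ']
    have h1 : (X j - ∑ l ∈ Finset.univ.erase j, C (b l) * X l :
        MvPolynomial (Fin (n + 1)) k).IsHomogeneous 1 :=
      (isHomogeneous_X k j).sub (IsHomogeneous.sum _ _ _ fun l _ ↦ hCX (b l) l)
    simpa using (isHomogeneous_C (Fin (n + 1)) (b j)⁻¹).mul h1
  have hsplit : ℓ - ∑ l ∈ Finset.univ.erase j, C (b l) * X l = C (b j) * X j := by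
    rw [hℓ, ← Finset.add_sum_erase Finset.univ (fun l ↦ C (b l) * X l) (Finset.mem_univ j),
      add_sub_cancel_right]
  set τ : Fin (n + 1) → MvPolynomial (Fin (n + 1)) k := Function.update (fun i ↦ X i) j ℓ with hτdef
  set τ' : Fin (n + 1) → MvPolynomial (Fin (n + 1)) k := Function.update (fun i ↦ X i) j ℓ' with hτ'def
  have hτj : τ j = ℓ := by rw [hτdef, Function.update_self]
  have hτ'j : τ' j = ℓ' := by rw [hτ'def, Function.update_self]
  have hτi : ∀ i, i ≠ j → τ i = X i := fun i hi ↦ by rw [hτdef, Function.update_of_ne hi]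
  have hτ'i : ∀ i, i ≠ j → τ' i = X i := fun i hi ↦ by rw [hτ'def, Function.update_of_ne hi]
  -- the sums over `l ≠ j` are fixed by both substitutions
  have hsumτ : aeval τ (∑ l ∈ Finset.univ.erase j, C (b l) * X l : MvPolynomial (Fin (n + 1)) k) =
      ∑ l ∈ Finset.univ.erase j, C (b l) * X l := by
    rw [map_sum]
    refine Finset.sum_congr rfl fun l hl ↦ ?_
    rw [map_mul, aeval_C, algebraMap_eq, aeval_X, hτi l (Finset.ne_of_mem_erase hl)]
  have hsumτ' : aeval τ' (∑ l ∈ Finset.univ.erase j, C (b l) * X l : MvPolynomial (Fin (n + 1)) k) =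
      ∑ l ∈ Finset.univ.erase j, C (b l) * X l := by
    rw [map_sum]
    refine Finset.sum_congr rfl fun l hl ↦ ?_
    rw [map_mul, aeval_C, algebraMap_eq, aeval_X, hτ'i l (Finset.ne_of_mem_erase hl)]
  refine ⟨τ, τ', fun i ↦ ?_, fun i ↦ ?_, fun q ↦ ?_, fun q ↦ ?_, hτj⟩
  · by_cases hi : i = j
    · rw [hi, hτj]; exact hℓh
    · rw [hτi i hi]; exact isHomogeneous_X k i
  · by_cases hi : i = j
    · rw [hi, hτ'j]; exact hℓ'h
    · rw [hτ'i i hi]; exact isHomogeneous_X k i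
  · suffices h : (aeval τ).comp (aeval τ') = AlgHom.id k _ from DFunLike.congr_fun h q
    refine MvPolynomial.algHom_ext fun i ↦ ?_
    rw [AlgHom.comp_apply, AlgHom.id_apply, aeval_X]
    by_cases hi : i = j
    · rw [hi, hτ'j, hℓ', map_mul, aeval_C, algebraMap_eq, map_sub, aeval_X, hτj, hsumτ, hsplit,
        ← mul_assoc, ← map_mul, inv_mul_cancel₀ hj, map_one, one_mul]
    · rw [hτ'i i hi, aeval_X, hτi i hi]
  · suffices h : (aeval τ').comp (aeval τ) = AlgHom.id k _ from DFunLike.congr_fun h q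
    refine MvPolynomial.algHom_ext fun i ↦ ?_
    rw [AlgHom.comp_apply, AlgHom.id_apply, aeval_X]
    by_cases hi : i = j
    · rw [hi, hτj]
      have h1 : aeval τ' ℓ = C (b j) * τ' j + ∑ l ∈ Finset.univ.erase j, C (b l) * X l := by
        rw [hℓ, ← Finset.add_sum_erase Finset.univ (fun l ↦ C (b l) * X l) (Finset.mem_univ j),
          map_add, map_mul, aeval_C, algebraMap_eq, aeval_X, hsumτ']
      rw [h1, hτ'j, hℓ', ← mul_assoc, ← map_mul, mul_inv_cancel₀ hj, map_one, one_mul,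
        sub_add_cancel]
    · rw [hτi i hi, aeval_X, hτ'i i hi]

end Subst

section SubstIso

variable {k : Type} [Field k] {n : ℕ}

/-- **An invertible linear substitution induces an automorphism of `ℙⁿ`**: for `σ_τ ∘ σ_{τ'} = id`
and `σ_{τ'} ∘ σ_τ = id`, `ProjectiveSpace.substMapHom τ` is an isomorphism with inverse
`substMapHom τ'` (functoriality of `Proj`, Mathlib `Proj.map_comp` / `Proj.map_id`).
[cite: Hartshorne1977, II Example 7.1.1] -/
theorem isIso_substMapHom (τ τ' : Fin (n + 1) → MvPolynomial (Fin (n + 1)) k)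
    (hτ : ∀ i, (τ i).IsHomogeneous 1) (hτ' : ∀ i, (τ' i).IsHomogeneous 1)
    (hinv : ∀ q, aeval τ (aeval τ' q) = q) (hinv' : ∀ q, aeval τ' (aeval τ q) = q) :
    IsIso (ProjectiveSpace.substMapHom τ hτ τ' hτ' hinv) := by
  letI := MvPolynomial.gradedAlgebra (σ := Fin (n + 1)) (R := k)
  have key : ∀ (φ : MvPolynomial.homogeneousSubmodule (Fin (n + 1)) k →+*ᵍ
      MvPolynomial.homogeneousSubmodule (Fin (n + 1)) k) (hφ : _),
      φ = GradedRingHom.id _ → Proj.map φ hφ = 𝟙 _ := by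
    rintro φ hφ rfl
    exact Proj.map_id
  have h1 : ProjectiveSpace.substMapHom τ hτ τ' hτ' hinv ≫ ProjectiveSpace.substMapHom τ' hτ' τ hτ hinv' =
      𝟙 _ := by
    rw [ProjectiveSpace.substMapHom_eq, ProjectiveSpace.substMapHom_eq, ← Proj.map_comp]
    refine key _ _ (GradedRingHom.ext fun q ↦ ?_)
    exact hinv q
  have h2 : ProjectiveSpace.substMapHom τ' hτ' τ hτ hinv' ≫ ProjectiveSpace.substMapHom τ hτ τ' hτ' hinv =
      𝟙 _ := by
    rw [ProjectiveSpace.substMapHom_eq, ProjectiveSpace.substMapHom_eq, ← Proj.map_comp]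
    refine key _ _ (GradedRingHom.ext fun q ↦ ?_)
    exact hinv' q
  exact ⟨⟨_, h1, h2⟩⟩

end SubstIso

/-! ### Dying off a closed set is a condition on its complex points -/

section Points

variable {X : SchemeOver ℂ}

/-- If every complex point of `Z` lies in `Z'`, a class dying off `Z` dies off `Z'` (restriction to
the smaller open subspace `(X ∖ Z')(ℂ) ⊆ (X ∖ Z)(ℂ)` factors). [cite: GrothendieckTopology1969, §1] -/
theorem restrictCompl_eq_zero_of_forall_pt {Z Z' : Set X.left}
    (h : ∀ P : ComplexPoints X, P.pt ∈ Z → P.pt ∈ Z') (i : ℕ) {x : complexBetti X i}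
    (hx : complexBetti.restrictCompl X Z i x = 0) : complexBetti.restrictCompl X Z' i x = 0 := by
  have hfac : (⟨Subtype.val, continuous_subtype_val⟩ :
      C(complexPointsCompl X Z', ComplexPoints X)) =
      (⟨Subtype.val, continuous_subtype_val⟩ :
        C(complexPointsCompl X Z, ComplexPoints X)).comp
        (⟨fun P ↦ ⟨P.1, fun h' ↦ P.2 (h P.1 h')⟩, by fun_prop⟩ :
          C(complexPointsCompl X Z', complexPointsCompl X Z)) :=
    ContinuousMap.ext fun _ ↦ rfl
  rw [complexBetti.restrictCompl, hfac, singularCohomology.map_comp, ModuleCat.comp_apply]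
  change singularCohomology.map ℂ ℂ _ i (complexBetti.restrictCompl X Z i x) = 0
  rw [hx, map_zero]

end Points

/-! ### The hyperplane section `X ∩ H_t` is a coordinate hyperplane section of a re-embedding -/

section Pencil

variable {N : ℕ} {X : SchemeOver ℂ} (ι : X ⟶ projectiveSpace N ℂ) [IsClosedImmersion ι.left]
  (a : Fin (1 + 1) → Fin (N + 1) → ℂ)

/-- **A re-embedding whose `j`-th coordinate hyperplane section is `X ∩ H_t`, on complex points.**
For the pencil `a = (a₀, a₁)` on `X ⊆ ℙᴺ` and `t = [w] ∈ ℙ¹(ℂ)` there are a closed immersion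
`ι' : X ⟶ ℙᴺ` (a linear change of coordinates of `ι`) and a chart index `j` such that every
complex point of `X` outside the chart `ι'⁻¹D₊(x_j)` lies in the image of
`u_t : π⁻¹(t) ⟶ X̃ ⟶ X`: with `ℓ = w₁ a₀ − w₀ a₁`, if `ℓ = 0` take `ι' = ι` (every complex point of
`X` is on `X ∩ V₊(0) = u_t(π⁻¹ t)`, `range_map_fiberι_blowDown`); otherwise `ℓ` has a non-zero
coefficient `b_j` and `ι' = ι ≫ σ_τ` with `τ_j = ℓ` (`exists_linearSubst_eq`), so that
`ι'⁻¹D₊(x_j) = ι⁻¹D₊(ℓ)` and its complement is `ι⁻¹V₊(ℓ) = u_t(π⁻¹ t)` (`range_hypersurfaceSectionι`,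
`range_map_fiberι_blowDown`). [cite: Hartshorne1977, II Example 7.1.1]
[cite: VoisinHodgeII2003, §2.1.1 and §2.3.1] -/
theorem exists_embedding_compl_chart_subset_range (w : Fin (1 + 1) → ℂ) (hw : w ≠ 0) :
    ∃ (ι' : X ⟶ projectiveSpace N ℂ) (_ : IsClosedImmersion ι'.left) (j : Fin (N + 1)),
      ∀ P : ComplexPoints X, P.pt ∉ (GeneratingSections.affineChartData ι').U j →
        P.pt ∈ Set.range (fiberι (proj ι a) (ProjectiveSpace.pointOfVec ℂ w hw) ≫
          blowDown ι a).left.base := by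
  classical
  letI := MvPolynomial.gradedAlgebra (σ := Fin (N + 1)) (R := ℂ)
  set e : ProjectiveEmbedding X := ⟨N, ι, inferInstance⟩ with hedef
  set b : Fin (N + 1) → ℂ := fun c ↦ w 1 * a 0 c - w 0 * a 1 c with hbdef
  have hℓ := isHomogeneous_linForm_member a w
  -- complex points of `ι⁻¹V₊(ℓ)` are in the image of `u_t`
  have key : ∀ P : ComplexPoints X, P.pt ∈ Set.range (e.hypersurfaceSectionι
      (Resolution.LinSec.linForm (fun c ↦ w 1 * a 0 c - w 0 * a 1 c)) hℓ).left.base →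
      P.pt ∈ Set.range (fiberι (proj ι a) (ProjectiveSpace.pointOfVec ℂ w hw) ≫
        blowDown ι a).left.base := fun P hP ↦ by
    have h1 : P ∈ Set.range (AlgPoints.map (L := ℂ) (e.hypersurfaceSectionι
        (Resolution.LinSec.linForm (fun c ↦ w 1 * a 0 c - w 0 * a 1 c)) hℓ)) :=
      ⟨AlgPoints.liftClosed _ P hP, AlgPoints.map_liftClosed _ _ hP⟩
    rw [← range_map_fiberι_blowDown ι a w hw] at h1
    obtain ⟨y, hy⟩ := h1
    exact ⟨y.pt, by rw [← hy, AlgPoints.pt_map]⟩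
  have hrange := range_hypersurfaceSectionι e
    (Resolution.LinSec.linForm (fun c ↦ w 1 * a 0 c - w 0 * a 1 c)) hℓ one_pos
  by_cases hb : b = 0
  · -- `ℓ = 0`: everything lies on `V₊(0)`
    refine ⟨ι, inferInstance, 0, fun P _ ↦ key P ?_⟩
    rw [hrange, Set.mem_preimage]
    have h0 : Resolution.LinSec.linForm (fun c ↦ w 1 * a 0 c - w 0 * a 1 c) = 0 := by
      change Resolution.LinSec.linForm b = 0
      rw [hb]
      simp [Resolution.LinSec.linForm]
    rw [h0]
    exact (ProjectiveSpectrum.mem_zeroLocus _ _ _).2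
      (Set.singleton_subset_iff.2 (HomogeneousIdeal.mem_iff.2 (Ideal.zero_mem _)))
  · -- `ℓ ≠ 0`: put `ℓ` in the `j`-th coordinate
    obtain ⟨j, hj⟩ : ∃ j, b j ≠ 0 := Function.ne_iff.mp hb
    obtain ⟨τ, τ', hτ, hτ', hinv, hinv', hτj⟩ := exists_linearSubst_eq b j hj
    haveI : IsIso (ProjectiveSpace.substMap τ hτ τ' hτ' hinv).left := by
      rw [ProjectiveSpace.substMap_left]
      exact isIso_substMapHom τ τ' hτ hτ' hinv hinv'
    refine ⟨ι ≫ ProjectiveSpace.substMap τ hτ τ' hτ' hinv, ?_, j, fun P hP ↦ key P ?_⟩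
    · rw [Over.comp_left]
      infer_instance
    rw [hrange, Set.mem_preimage]
    have hℓb : Resolution.LinSec.linForm (fun c ↦ w 1 * a 0 c - w 0 * a 1 c) = τ j := by
      rw [hτj]
      rfl
    -- `P ∉ (ι ≫ σ_τ)⁻¹ D₊(x_j) = ι⁻¹ D₊(τ_j)`
    have hP' : ¬ (ι.left.base P.pt ∈ Proj.basicOpen (MvPolynomial.homogeneousSubmodule (Fin (N + 1)) ℂ)
        (ProjectiveSpace.substGraded τ hτ (MvPolynomial.X j))) := hP
    have hP'' : ProjectiveSpace.substGraded τ hτ (MvPolynomial.X j) ∈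
        (ι.left.base P.pt).asHomogeneousIdeal := not_not.1 hP'
    rw [ProjectiveSpace.substGraded_apply, aeval_X] at hP''
    rw [hℓb]
    exact (ProjectiveSpectrum.mem_zeroLocus _ _ _).2 (Set.singleton_subset_iff.2 hP'')

end Pencil

/-! ### The main theorem -/

section Main

variable {m N : ℕ} {X : SchemeOver ℂ}

/-- **Cup product with the class of a smooth member of a Lefschetz pencil is injective below the
middle degree.** For `X ⊆ ℙᴺ` smooth projective of dimension `m + 1`, a pencil `a` and a complex
point `t ∈ ℙ¹(ℂ)` with smooth projective fibre `π⁻¹(t)` of dimension `m`, and `2p ≤ m`: if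
`z ∈ H^{2p}(X(ℂ); ℂ)` satisfies `z ∪ (u_t)_* 1 = 0`, `u_t : π⁻¹(t) ⟶ X̃ ⟶ X`, then `z = 0`. For the
hyperplane-type class `H` of a re-embedding `ι'` of `X` adapted to `H_t`
(`exists_embedding_compl_chart_subset_range`), `H` dies off `u_t(π⁻¹ t)`
(`HodgeModel.restrictCompl_eq_zero_of_pullback_eq_fubiniStudy`, `restrictCompl_eq_zero_of_forall_pt`),
so `H = κ (u_t)_* 1` (Thom–Gysin, `exists_complexGysin_eq_of_isClosedImmersion`, and
`H⁰(π⁻¹(t)(ℂ)) = ℂ · 1`); a multiple `w H`, `w ≠ 0`, is the class of a hard Lefschetz datum `Λ`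
(`HodgeModel.exists_hardLefschetzNFold_of_pullback_eq_fubiniStudy_smul`), so
`L_Λ z = w κ (z ∪ (u_t)_* 1)` up to the (trivial) sign of graded commutativity, and `L_Λ` is
injective on `H^{2p}` for `2p + 1 ≤ m + 1` (`injective_lefschetzPowTo_of_le`). In print: "`[X_t]` is
the hyperplane class `h`, and `∪ h : H^{2p}(X) → H^{2p+2}(X)` is injective for `2p < dim X`" (hard
Lefschetz, Voisin I Thm. 6.25; the step "`u^* a` algebraic ⟹ `a` algebraic" of de Cataldo–Migliorini
§4 / Thomas §2 uses exactly this injectivity). [cite: VoisinHodgeI2002, §6.2.3 Thm. 6.25 and §7.1.2]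
[cite: VoisinHodgeII2003, §1.2.2 Thm. 1.23] [cite: DecataldoMigliorini2009, §4 proof of Prop. 4.5] -/
theorem eq_zero_of_cupProduct_complexGysin_one_eq_zero (hX : IsSmoothProjective (m + 1) X)
    (ι : X ⟶ projectiveSpace N ℂ) [IsClosedImmersion ι.left] (a : Fin (1 + 1) → Fin (N + 1) → ℂ)
    (t : ComplexPoints (projectiveSpace 1 ℂ))
    (hY : IsSmoothProjective m (fiberOver (proj ι a) t)) (μ : OrientationFamily)
    {p : ℕ} (hpm : 2 * p ≤ m) {z : complexBetti X (2 * p)}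
    (hz : cupProduct (show 2 * p + 2 = 2 * (p + 1) by ring) z
      (complexGysin μ hY hX (fiberι (proj ι a) t ≫ blowDown ι a)
        (show 0 + 2 * (m + 1) = 2 + 2 * m by ring)
        (singularCohomology.one ℂ (ComplexPoints (fiberOver (proj ι a) t)))) = 0) :
    z = 0 := by
  obtain ⟨w, hw, rfl⟩ := ProjectiveSpace.exists_eq_pointOfVec t
  set tt : ComplexPoints (projectiveSpace 1 ℂ) := ProjectiveSpace.pointOfVec ℂ w hw with htt
  set u := fiberι (proj ι a) tt ≫ blowDown ι a with hudef
  haveI : IsClosedImmersion u.left := isClosedImmersion_fiberι_blowDown_left ι a tt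
  set g : complexBetti X 2 := complexGysin μ hY hX u (show 0 + 2 * (m + 1) = 2 + 2 * m by ring)
    (singularCohomology.one ℂ (ComplexPoints (fiberOver (proj ι a) tt))) with hgdef
  -- the hyperplane-type class `H` of an adapted re-embedding, and its hard Lefschetz datum
  obtain ⟨ι', hι', j, hsub⟩ := exists_embedding_compl_chart_subset_range ι a w hw
  haveI := hι'
  obtain ⟨A⟩ := (nonempty_hodgeModel_holds (n := m + 1) (X := X)).nonempty hX
  obtain ⟨e, he, hem, -⟩ := exists_deRhamIsoFamily_holds A.model
  have hθ := A.fubiniStudyPullbackForm_mem_closedSmoothForms ι'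
  obtain ⟨H, hH⟩ := A.pullback_surjective 2 (ofRealClass A.carrier 2 (e A.carrier 2
    (deRhamCohomology.mk ⟨fubiniStudyPullbackForm A.model ι' A.toComplexPoints, hθ⟩)))
  obtain ⟨r, hr, hrat⟩ :=
    exists_ne_zero_smul_isRationalClass_of_pullback_eq_fubiniStudy hX A ι' e he hθ hH
  obtain ⟨Λ, hΛ⟩ := A.exists_hardLefschetzNFold_of_pullback_eq_fubiniStudy_smul ι' e hX he hem hθ hH hr hrat
  -- `H` dies off `u_t(π⁻¹ t)`, hence `H = κ • g`
  have hHsupp : complexBetti.restrictCompl X (Set.range u.left.base) 2 H = 0 :=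
    restrictCompl_eq_zero_of_forall_pt (fun P hP ↦ hsub P hP) 2
      (A.restrictCompl_eq_zero_of_pullback_eq_fubiniStudy ι' e he hθ hH j)
  obtain ⟨y, hy⟩ := exists_complexGysin_eq_of_isClosedImmersion μ hX hY u
    (show 0 + 2 * (m + 1) = 2 + 2 * m by ring) hHsupp
  obtain ⟨κ, rfl⟩ := exists_eq_smul_one μ hY y
  have hHg : H = κ • g := by rw [← hy, map_smul]
  -- hard Lefschetz: `L_Λ` is injective on `H^{2p}`
  have hinj := injective_lefschetzPowTo_of_le Λ.hyperplaneClass (m + 1) Λ.hasHardLefschetz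
    (a := 2 * p) (t := 1) (by omega) (show 2 * p + 2 * 1 = 2 * (p + 1) by ring)
  apply hinj
  rw [map_zero, lefschetzPowTo_succ_apply Λ.hyperplaneClass 0 (2 * p) (2 * p) (2 * (p + 1)) rfl
    (show 2 * p + 2 * 1 = 2 * (p + 1) by ring) (show 2 + 2 * p = 2 * (p + 1) by ring),
    lefschetzPowTo_zero_apply, lefschetzOperator_apply, hΛ, hHg, smul_smul,
    cupProduct_gradedComm_holds ℂ (ComplexPoints X) (show 2 + 2 * p = 2 * (p + 1) by ring)
      (show 2 * p + 2 = 2 * (p + 1) by ring), Even.neg_one_pow ⟨2 * p, by ring⟩, one_smul,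
    map_smul, hz, smul_zero]

end Main

end HodgeTheory

end Literature.AlgebraicGeometry.HodgeTheory

end
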